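import Literature.Computability.AlgebraicComplexity.Bur24UnboundedDegreeClassesField
import Literature.NumberTheory.LFunctions.DedekindZeta
import HarnessLib

/-!
# `VP = VNP ⟹ VPnb = VNPnb` in characteristic zero under GRH (Bürgisser 2024, Thm. 4.10 (2))

P. Bürgisser, *Completeness classes in algebraic complexity theory*, arXiv:2406.06217 (2024), §4.2
(held text `paper:arxiv-2406.06217`, p0017). After Cor. 4.7 (L19–22: every `VNPnb^{𝔽_p}` sequence
is obtained from a `VNP^{𝔽_p}` sequence by substitutions `z ↦ x^{2^ℓ}` with p-bounded `ℓ`) and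
Malod's Thm. 4.8 (L29–42: in positive characteristic `VP^{𝔽_p} = VNP^{𝔽_p} ⟺ VPnb^{𝔽_p} =
VNPnb^{𝔽_p}`), the survey states (L57–75):

> As far as conditional statements are concerned, this difficulty can be overcome using a result
> from [buerg:09]. We obtain the following somewhat subtle extension of Theorem 4.8, compare
> [koir-per:11, poizat:14]; the assertion (2) appears to be new.
> **Theorem 4.10.** (1) We have for the constant-free classes, `VP⁰ = VNP⁰ ⟹ VPnb⁰ = VNPnb⁰`.
> (2) Over any field `𝔽` of characteristic zero, assuming the Generalized Riemann Hypothesis,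
> `VP^𝔽 = VNP^𝔽 ⟺ VPnb^𝔽 = VNPnb^𝔽`.

with the proof outline (L77–103): `VP^𝔽 = VNP^𝔽` implies `VP^{𝔽̄} = VNP^{𝔽̄}`; by [buerg:00]
(Bürgisser, *Cook's versus Valiant's hypothesis*, TCS 235 (2000), Cor. 4.6 — in the tree the named
fact `PPoly_eq_polyAdvice_NP_of_VP_eq_VNP`) this gives `#P ⊆ P/poly` under GRH, hence the
counting hierarchy collapses to `P/poly`; the bits of the binomial coefficients met when computing
a monomial of the generic computation are then in `P/poly` ([buerg:09], *On defining integers and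
proving arithmetic circuit lower bounds*), and "the `VNP⁰`-complete sequence `(D_n)` can be
obtained from a sequence in `VP⁰` by variable substitutions `z ↦ x^{2^ℓ}` with polynomially bounded
`ℓ`. Hence `(D_n) ∈ VPnb`." The direction `⟸` "follows by Remark 4.9" — PROVED in the tree over
every commutative ring as `Bur24_rem_4_9`.

Rendering. ONE named fact, `Bur24_thm_4_10_2 F`: for a field `F` of characteristic zero, the
Extended Riemann Hypothesis (`Literature.NumberTheory.LFunctions.ExtendedRiemannHypothesis`, the
tree's GRH, as in `PPoly_eq_polyAdvice_NP_of_VP_eq_VNP` and `booleanPart_VP_cktSize`) and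
`VP F = VNP F` (the tree's bundled classes of `ValiantClasses.lean`) imply `VNPnb^F ⊆ VPnb^F` for
families on the variable sets `Fin (v n)` (`IsVNPnbFamily`, `IsVPnbFamily` of
`Bur24UnboundedDegreeClassesField.lean`; the inclusion `VPnb ⊆ VNPnb` is unconditional,
`IsVPnbFamily.isVNPnbFamily`, so this IS the equality `VPnb^F = VNPnb^F`). Assertion (1) concerns
the constant-free classes and is not rendered here. Statement only — the proof rests on the
GRH-conditional Boolean part theorem [buerg:00, Cor. 4.6] (a named fact in the tree) and on the
counting-hierarchy bound for bits of binomial coefficients [buerg:09] (not in the tree); no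
discharge is attempted. Not to be confused with the unconditional positive-characteristic
Thm. 4.8 (Malod 2007). No instances, no notation.

USE (why this fact is typed). Together with the presentable-border interpolation
`\overline{VP}_ε ∩ {p-families} ⊆ VNPnb^ℂ` (Bhargav–Dwivedi–Saxena 2024, Lemma 4.1; tree file
`BDS24ExponentialInterpolation`, `IsPresVPBarFamily.isVNPnbFamily`) it yields, under GRH,
`VP = VNP ⟹ \overline{VP}_ε ∩ {p-families} ⊆ VPnb ∩ {p-families} = VP` over `ℂ`: the collapse
de-borders the presentable closure (route `VPBoundarySquare`, item `CollapseDebordersPresentable`).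

## References

* [Burgisser2024Completeness] P. Bürgisser, arXiv:2406.06217 (2024), §4.2, Cor. 4.7, Thm. 4.8,
  Rem. 4.9, Thm. 4.10 with proof outline (p0017 L19–L103).
* [Burgisser2000] P. Bürgisser, *Cook's versus Valiant's hypothesis*, Theoret. Comput. Sci. 235
  (2000) 71–88, Cor. 4.6 (the GRH-conditional Boolean parts of `VP = VNP`).
* P. Bürgisser, *On defining integers and proving arithmetic circuit lower bounds*, Comput.
  Complexity 18 (2009) 81–103 ([buerg:09] of the survey).
* G. Malod, *The complexity of polynomials and their coefficient functions*, CCC 2007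
  ([malod:07] of the survey; Thm. 4.8).
-/

noncomputable section

open MvPolynomial

namespace Literature.Computability.AlgebraicComplexity

universe u

/-- **Bürgisser 2024, Thm. 4.10 (2)** ("Over any field `𝔽` of characteristic zero, assuming the
Generalized Riemann Hypothesis, `VP^𝔽 = VNP^𝔽 ⟺ VPnb^𝔽 = VNPnb^𝔽`"; "the assertion (2) appears
to be new"), direction `⟹`, rendered by the non-trivial inclusion: in characteristic zero, ERH and
`VP F = VNP F` give `VNPnb^F ⊆ VPnb^F` — every p-bounded Boolean sum of p-size circuits (no degree
bound) over `F` is computed by p-size circuits. (`⟸` is `Bur24_rem_4_9`, proved.)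
[cite: Burgisser2024Completeness, Thm. 4.10 (2) (p0017 L71–L75, proof outline L92–L103)] [status: conditional (GRH); proof via Burgisser2000 Cor. 4.6 and buerg:09] -/
def Bur24_thm_4_10_2 (F : Type u) [Field F] : Prop :=
  ∀ [CharZero F], Literature.NumberTheory.LFunctions.ExtendedRiemannHypothesis → VP F = VNP F →
    ∀ (v : ℕ → ℕ) (f : ∀ n, MvPolynomial (Fin (v n)) F), IsVNPnbFamily f → IsVPnbFamily f

end Literature.Computability.AlgebraicComplexity

end
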